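import Summits.AtomisticToContinuum.Crystallization.Theorems.OverbindingBudgetAffineCompressedCutFrame
import Summits.AtomisticToContinuum.Crystallization.Theorems.OverbindingBudgetAffineCompressedCutChains
import Summits.AtomisticToContinuum.Crystallization.Theorems.OverbindingBudgetAffineCompressedCutScale

/-!
# OverbindingBudget · AffineCompressedCut — rider «Core» (lens-4 g82, head start on (iii) = the 79K energy inequality, part II)

Cell `decomp-a2c`, seat lens-4, generation 82.  ELEMENTARY·PROVED, no new numeric hypothesis, no new `Prop` definitions.

SCALE COHERENCE ON THE CORE OF AN AFFINELY DEEP BALL — the first application of the g79 percolation bricks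
(`…Chains.chains_exist_record`, `…Scale.affFramed_scale_transfer_record`), which so far nobody consumed.  The energy inequality behind the open
leaf `…CompressedCutFirst.NearFieldSlackMinSecond 12 (1/25)` bounds the attractive tail beyond the layer-rigidity radius by volume packing
(rider «Tail», `…CompressedCutTail.sum_inv_pow_six_le_grid_scaled`), which needs a SEPARATION `σ·nn_i` on annuli of the `12·nn_i`-ball, i.e. a
FLOOR for `nn_k` there.  This file derives it from the leaf's own site hypothesis:

* ★ `scale_window_of_charts` — GENERIC (re-basable) form: chart data `A, Q, P, f` with the three registration hypotheses + injectivity of the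
  registrations + affine framing on the `R·nn_b`-ball of a base site `b` (`0 < nn_b`), a cut-off radius `ρ'` with `ρ' + 1.0011^L ≤ R`, a core
  radius `r₁` with `2r₁ ≤ ρ'` and `r₁ < L·(9967/10⁴)^L/5` ⟹ every site `k` of the `r₁·nn_b`-core has `nn_k ∈ [(9967/10⁴)^L, (1.0011)^L]·nn_b`.
  Mechanism: CUT the pattern assignment OFF outside the `ρ'`-ball (`P' j = ∅` there), so that every first-shell chain registered w.r.t. `P'`
  stays inside the `R`-ball (induction `walk`: site `t` of a chain lies within `ρ'·nn_b + 1.0011^t·nn_b` of `y b`, its scale in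
  `[(9967/10⁴)^t, 1.0011^t]·nn_b`, by `affFramed_scale_transfer_record` / `nearestDist_le_of_dist_le` one bond at a time); this discharges the
  scale input `hscale` of `chains_exist_record`, which then reaches every site of the core by a registered chain of length `≤ L`.
* ★★ `core_scale_window` — RECORD case under the leaf's hypothesis: `Function.Injective y`, `0 < nn_i`,
  `AffDeepReg 12 (1/10^4) (1/1000) (1/450) y i` ⟹ `∀ k, dist (y k) (y i) ≤ (219/40)·nn_i → (9/10)·nn_i ≤ nn_k ≤ (26/25)·nn_i`
  (`(R, ρ', r₁, L) = (12, 219/20, 219/40, 31)`: `219/20 + 1.0011³¹ = 11.985 ≤ 12`, `219/40 = 5.475 < 31·0.9026/5 = 5.596`, `0.9967³¹ = 0.9026 ≥ 9/10`,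
  `1.0011³¹ = 1.0347 ≤ 26/25`); chart data from `…Frame.charts_of_affDeepReg`.
* `registered_step` — one registered first-shell step from a charted site: distinct index and length `≤ 1.0011·nn`.

Re-based stages (g83 «Stage»): apply `scale_window_of_charts` at a core site `b = j` with the SAME chart data and `R·nn_j + dist (y j) (y i) ≤ 12·nn_i`
(the ball hypotheses on `B(j, R·nn_j) ⊆ B(i, 12·nn_i)` are the given ones); POINTERS-g83 §4c has the stage table.
-/

namespace Summit.AtomisticToContinuum.Crystallization.Theorems.OverbindingBudgetAffineCompressedCutCore

open Literature.Geometry.DiscreteGeometry (nearestDist nearestDist_nonneg nearestDist_le_dist fccTwoShellPattern hcpTwoShellPattern)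
open Summit.AtomisticToContinuum.Crystallization.Theorems.OverbindingBudgetAffineLadder (AffFramed AffDeepReg)
open Summit.AtomisticToContinuum.Crystallization.Theorems.OverbindingBudgetAffineCompressedCutEstablish (nearestDist_pos_of_frame)
open Summit.AtomisticToContinuum.Crystallization.Theorems.OverbindingBudgetAffineCompressedCutFrame (charts_of_affDeepReg)
open Summit.AtomisticToContinuum.Crystallization.Theorems.OverbindingBudgetAffineCompressedCutChains (chains_exist_record)
open Summit.AtomisticToContinuum.Crystallization.Theorems.OverbindingBudgetAffineCompressedCutScale (affFramed_scale_transfer_record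
  nearestDist_le_of_dist_le)

variable {N : ℕ}

/-- **ONE REGISTERED STEP.**  From a charted site `j` (pattern `fcc ∨ hcp`, frame within `10⁻³` of an isometry, registration at tolerance
`10⁻⁴·nn_j` into `range y`, injective on the pattern) a registered first-shell neighbour `y k = f v` (`v ∈ P`, `‖v‖ = 1`) is a DIFFERENT site at
distance `≤ (1 + 1/1000 + 1/10^4)·nn_j`. [this file] -/
theorem registered_step {y : Fin N → EuclideanSpace ℝ (Fin 3)} (hy : Function.Injective y) {j k : Fin N}
    {Aj : EuclideanSpace ℝ (Fin 3) →ₗ[ℝ] EuclideanSpace ℝ (Fin 3)} {Qj : EuclideanSpace ℝ (Fin 3) →ₗᵢ[ℝ] EuclideanSpace ℝ (Fin 3)}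
    {Pj : Finset (EuclideanSpace ℝ (Fin 3))} {fj : EuclideanSpace ℝ (Fin 3) → EuclideanSpace ℝ (Fin 3)}
    (hP : Pj = fccTwoShellPattern ∨ Pj = hcpTwoShellPattern) (hA : ∀ v ∈ Pj, ‖Aj v - Qj v‖ ≤ 1 / 1000)
    (hf : ∀ v ∈ Pj, fj v ∈ Set.range y ∧ dist (fj v) (y j + nearestDist y j • Aj v) ≤ 1 / 10 ^ 4 * nearestDist y j)
    (hinj : Set.InjOn fj ↑Pj) {v : EuclideanSpace ℝ (Fin 3)} (hv : v ∈ Pj) (hv1 : ‖v‖ = 1) (hk : y k = fj v) :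
    k ≠ j ∧ dist (y k) (y j) ≤ (1 + 1 / 1000 + 1 / 10 ^ 4) * nearestDist y j := by
  have hnn : 0 < nearestDist y j := nearestDist_pos_of_frame hy hP (fun v hv => (hf v hv).1) hinj
  have h1 := (hf v hv).2
  have hQ : ‖Qj v‖ = 1 := by rw [LinearIsometry.norm_map, hv1]
  have hAup : ‖Aj v‖ ≤ 1 + 1 / 1000 := by
    calc ‖Aj v‖ = ‖(Aj v - Qj v) + Qj v‖ := by rw [sub_add_cancel]
      _ ≤ ‖Aj v - Qj v‖ + ‖Qj v‖ := norm_add_le _ _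
      _ ≤ 1 / 1000 + 1 := add_le_add (hA v hv) hQ.le
      _ = 1 + 1 / 1000 := by ring
  have hAlo : 1 - 1 / 1000 ≤ ‖Aj v‖ := by
    have : ‖Qj v‖ ≤ ‖Aj v‖ + ‖Aj v - Qj v‖ := by
      calc ‖Qj v‖ = ‖Aj v - (Aj v - Qj v)‖ := by rw [sub_sub_cancel]
        _ ≤ ‖Aj v‖ + ‖Aj v - Qj v‖ := norm_sub_le _ _
    linarith [hA v hv]
  have hsm : ‖nearestDist y j • Aj v‖ = nearestDist y j * ‖Aj v‖ := by rw [norm_smul, Real.norm_of_nonneg hnn.le]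
  refine ⟨fun hkj => ?_, ?_⟩
  · rw [hkj] at hk
    rw [← hk, dist_comm, dist_eq_norm, add_sub_cancel_left, hsm] at h1
    nlinarith [mul_le_mul_of_nonneg_left hAlo hnn.le]
  · have hd : dist (y k) (y j) ≤ dist (y k) (y j + nearestDist y j • Aj v) + ‖nearestDist y j • Aj v‖ := by
      have := dist_triangle (y k) (y j + nearestDist y j • Aj v) (y j)
      rwa [dist_eq_norm (y j + _) (y j), add_sub_cancel_left] at this
    rw [hsm, hk] at hd
    rw [hk]
    nlinarith [mul_le_mul_of_nonneg_left hAup hnn.le]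

/-- ★ **SCALE WINDOW ON THE CORE (generic, re-basable).**  See the module docstring. [this file] -/
theorem scale_window_of_charts {y : Fin N → EuclideanSpace ℝ (Fin 3)} (hy : Function.Injective y) {b : Fin N} (hν : 0 < nearestDist y b)
    {A : Fin N → (EuclideanSpace ℝ (Fin 3) →ₗ[ℝ] EuclideanSpace ℝ (Fin 3))} {Q : Fin N → (EuclideanSpace ℝ (Fin 3) →ₗᵢ[ℝ] EuclideanSpace ℝ (Fin 3))}
    {P : Fin N → Finset (EuclideanSpace ℝ (Fin 3))} {f : Fin N → EuclideanSpace ℝ (Fin 3) → EuclideanSpace ℝ (Fin 3)}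
    {R ρ' r₁ : ℝ} {L : ℕ}
    (hP : ∀ j, dist (y j) (y b) ≤ R * nearestDist y b → P j = fccTwoShellPattern ∨ P j = hcpTwoShellPattern)
    (hA : ∀ j, dist (y j) (y b) ≤ R * nearestDist y b → ∀ v ∈ P j, ‖A j v - Q j v‖ ≤ 1 / 1000)
    (hf : ∀ j, dist (y j) (y b) ≤ R * nearestDist y b →
      ∀ v ∈ P j, f j v ∈ Set.range y ∧ dist (f j v) (y j + nearestDist y j • A j v) ≤ 1 / 10 ^ 4 * nearestDist y j)
    (hinj : ∀ j, dist (y j) (y b) ≤ R * nearestDist y b → Set.InjOn (f j) ↑(P j))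
    (hfr : ∀ j, dist (y j) (y b) ≤ R * nearestDist y b → AffFramed (1 / 10 ^ 4) (1 / 1000) (1 / 450) y j)
    (hRρ : ρ' + (10011 / 10000) ^ L ≤ R) (hρ : 2 * r₁ ≤ ρ') (hL : r₁ < L * (1 / 5) * (9967 / 10000) ^ L) :
    ∀ k, dist (y k) (y b) ≤ r₁ * nearestDist y b →
      (9967 / 10000) ^ L * nearestDist y b ≤ nearestDist y k ∧ nearestDist y k ≤ (10011 / 10000) ^ L * nearestDist y b := by
  classical
  have hμ1 : (1 : ℝ) ≤ 10011 / 10000 := by norm_num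
  have hμL : (1 : ℝ) ≤ (10011 / 10000) ^ L := one_le_pow₀ hμ1
  have hρR : ρ' ≤ R := by linarith
  -- the cut-off pattern assignment: empty outside the `ρ'`-ball
  set P' : Fin N → Finset (EuclideanSpace ℝ (Fin 3)) := fun j => if dist (y j) (y b) ≤ ρ' * nearestDist y b then P j else ∅ with hP'_def
  have hP'eq : ∀ j, dist (y j) (y b) ≤ ρ' * nearestDist y b → P' j = P j := fun j hj => by simp only [hP'_def, if_pos hj]
  have hballR : ∀ j, dist (y j) (y b) ≤ ρ' * nearestDist y b → dist (y j) (y b) ≤ R * nearestDist y b :=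
    fun j hj => hj.trans (mul_le_mul_of_nonneg_right hρR hν.le)
  have hP' : ∀ j, dist (y j) (y b) ≤ ρ' * nearestDist y b → P' j = fccTwoShellPattern ∨ P' j = hcpTwoShellPattern :=
    fun j hj => by rw [hP'eq j hj]; exact hP j (hballR j hj)
  have hA' : ∀ j, dist (y j) (y b) ≤ ρ' * nearestDist y b → ∀ v ∈ P' j, ‖A j v - Q j v‖ ≤ 1 / 1000 :=
    fun j hj v hv => hA j (hballR j hj) v (by rwa [hP'eq j hj] at hv)
  have hf' : ∀ j, dist (y j) (y b) ≤ ρ' * nearestDist y b →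
      ∀ v ∈ P' j, f j v ∈ Set.range y ∧ dist (f j v) (y j + nearestDist y j • A j v) ≤ 1 / 10 ^ 4 * nearestDist y j :=
    fun j hj v hv => hf j (hballR j hj) v (by rwa [hP'eq j hj] at hv)
  intro k hk
  have hr0 : 0 ≤ r₁ := by nlinarith [dist_nonneg.trans hk]
  have hR0 : 0 ≤ R := by linarith
  -- WALK along a `P'`-registered chain: containment in the `R`-ball and the two-sided scale window, one bond at a time
  have walk : ∀ ℓ ≤ L, ∀ c : ℕ → Fin N, c 0 = b → (∀ t < ℓ, ∃ v ∈ P' (c t), ‖v‖ = 1 ∧ y (c (t + 1)) = f (c t) v) →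
      ∀ t ≤ ℓ, dist (y (c t)) (y b) ≤ R * nearestDist y b ∧ (9967 / 10000) ^ t * nearestDist y b ≤ nearestDist y (c t) ∧
        nearestDist y (c t) ≤ (10011 / 10000) ^ t * nearestDist y b := by
    intro ℓ hℓ c hc0 hreg t
    induction t with
    | zero =>
      intro _
      rw [hc0, dist_self, pow_zero, pow_zero, one_mul]
      exact ⟨mul_nonneg hR0 hν.le, le_rfl, le_rfl⟩
    | succ t ih =>
      intro ht
      have ht' : t < ℓ := by omega
      obtain ⟨hjR, hlo, hup⟩ := ih (by omega)
      obtain ⟨v, hv', hv1, hct⟩ := hreg t ht'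
      have hin : dist (y (c t)) (y b) ≤ ρ' * nearestDist y b := by
        by_contra h
        rw [hP'_def] at hv'
        simp only [if_neg h] at hv'
        simp at hv'
      have hv : v ∈ P (c t) := by rwa [hP'eq _ hin] at hv'
      obtain ⟨hne, hd⟩ := registered_step hy (hP _ hjR) (hA _ hjR) (hf _ hjR) (hinj _ hjR) hv hv1 hct
      have hμ : (1 + 1 / 1000 + 1 / 10 ^ 4 : ℝ) = 10011 / 10000 := by norm_num
      have hdist : dist (y (c (t + 1))) (y b) ≤ R * nearestDist y b := by
        have h1 : dist (y (c (t + 1))) (y b) ≤ dist (y (c (t + 1))) (y (c t)) + dist (y (c t)) (y b) := dist_triangle _ _ _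
        have h2 : (10011 / 10000 : ℝ) * nearestDist y (c t) ≤ 10011 / 10000 * ((10011 / 10000) ^ t * nearestDist y b) :=
          mul_le_mul_of_nonneg_left hup (by norm_num)
        have h3 : ((10011 / 10000 : ℝ)) ^ (t + 1) ≤ (10011 / 10000) ^ L := pow_le_pow_right₀ hμ1 (by omega)
        have h4 : ((10011 / 10000 : ℝ)) ^ (t + 1) * nearestDist y b ≤ (10011 / 10000) ^ L * nearestDist y b :=
          mul_le_mul_of_nonneg_right h3 hν.le
        have h5 : (10011 / 10000 : ℝ) * ((10011 / 10000) ^ t * nearestDist y b) = (10011 / 10000) ^ (t + 1) * nearestDist y b := by ring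
        rw [hμ] at hd
        nlinarith
      refine ⟨hdist, ?_, ?_⟩
      · have h := affFramed_scale_transfer_record hy (hfr _ hjR) (hfr _ hdist) hne hd
        calc ((9967 / 10000 : ℝ)) ^ (t + 1) * nearestDist y b = 9967 / 10000 * ((9967 / 10000) ^ t * nearestDist y b) := by ring
          _ ≤ 9967 / 10000 * nearestDist y (c t) := mul_le_mul_of_nonneg_left hlo (by norm_num)
          _ ≤ nearestDist y (c (t + 1)) := h
      · have h := nearestDist_le_of_dist_le hne hd
        rw [hμ] at h
        calc nearestDist y (c (t + 1)) ≤ 10011 / 10000 * nearestDist y (c t) := h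
          _ ≤ 10011 / 10000 * ((10011 / 10000) ^ t * nearestDist y b) := mul_le_mul_of_nonneg_left hup (by norm_num)
          _ = (10011 / 10000) ^ (t + 1) * nearestDist y b := by ring
  -- the scale input of `chains_exist_record`, then the chain to `k`
  have hσL : ∀ ℓ ≤ L, ((9967 / 10000 : ℝ)) ^ L * nearestDist y b ≤ (9967 / 10000) ^ ℓ * nearestDist y b :=
    fun ℓ hℓ => mul_le_mul_of_nonneg_right (pow_le_pow_of_le_one (by norm_num) (by norm_num) hℓ) hν.le
  have hscale : ∀ ℓ ≤ L, ∀ c : ℕ → Fin N, c 0 = b → (∀ t < ℓ, ∃ v ∈ P' (c t), ‖v‖ = 1 ∧ y (c (t + 1)) = f (c t) v) →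
      (9967 / 10000) ^ L * nearestDist y b ≤ nearestDist y (c ℓ) :=
    fun ℓ hℓ c hc0 hreg => (hσL ℓ hℓ).trans (walk ℓ hℓ c hc0 hreg ℓ le_rfl).2.1
  obtain ⟨ℓ, hℓ, c, hc0, hcℓ, hreg, -⟩ :=
    chains_exist_record (A := A) (Q := Q) (P := P') (f := f) hν hρ hL hP' hA' hf' hscale k hk
  obtain ⟨-, hlo, hup⟩ := walk ℓ hℓ c hc0 hreg ℓ le_rfl
  rw [hcℓ] at hlo hup
  exact ⟨(hσL ℓ hℓ).trans hlo, hup.trans (mul_le_mul_of_nonneg_right (pow_le_pow_right₀ hμ1 hℓ) hν.le)⟩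

/-- ★★ **CORE SCALE WINDOW UNDER THE LEAF'S HYPOTHESIS** (record): `AffDeepReg 12 (1/10^4) (1/1000) (1/450) y i`, `Function.Injective y`,
`0 < nn_i` ⟹ every site `k` with `dist (y k) (y i) ≤ (219/40)·nn_i` has `(9/10)·nn_i ≤ nn_k ≤ (26/25)·nn_i`. [this file] -/
theorem core_scale_window {y : Fin N → EuclideanSpace ℝ (Fin 3)} (hy : Function.Injective y) {i : Fin N} (hν : 0 < nearestDist y i)
    (hreg : AffDeepReg 12 (1 / 10 ^ 4) (1 / 1000) (1 / 450) y i) :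
    ∀ k, dist (y k) (y i) ≤ 219 / 40 * nearestDist y i →
      9 / 10 * nearestDist y i ≤ nearestDist y k ∧ nearestDist y k ≤ 26 / 25 * nearestDist y i := by
  obtain ⟨A, Q, P, f, hP, hA, hf, hinj, -, -, -⟩ := charts_of_affDeepReg hreg
  have hfr : ∀ j, dist (y j) (y i) ≤ 12 * nearestDist y i → AffFramed (1 / 10 ^ 4) (1 / 1000) (1 / 450) y j :=
    fun j hj => (hreg j hj).2
  intro k hk
  have h := scale_window_of_charts (R := 12) (ρ' := 219 / 20) (r₁ := 219 / 40) (L := 31) hy hν hP hA hf hinj hfr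
    (by norm_num) (by norm_num) (by norm_num) k hk
  have e1 : (9 / 10 : ℝ) ≤ (9967 / 10000) ^ 31 := by norm_num
  have e2 : ((10011 / 10000 : ℝ)) ^ 31 ≤ 26 / 25 := by norm_num
  exact ⟨le_trans (mul_le_mul_of_nonneg_right e1 hν.le) h.1, h.2.trans (mul_le_mul_of_nonneg_right e2 hν.le)⟩

end Summit.AtomisticToContinuum.Crystallization.Theorems.OverbindingBudgetAffineCompressedCutCore
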